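import Summits.QuantumAdvantage.QuantumAdvantage.Theses.ArithStatLadder
import Literature.NumberTheory.QuadraticFields.ThreeTorsion
import Literature.NumberTheory.QuadraticFields.ThreeTorsionMean
import Literature.NumberTheory.QuadraticFields.ReducedForms
import Literature.NumberTheory.CubicFields.BinaryCubicForms

/-!
# Sketch — crux-ideate AcZeroRung (stmt-QuantumAdvantage-2425), gen 2, round 1, ideator 2

First-lemma signatures for the two idea cards of this seat:

* `heegner-norm-diagonal` — Soundararajan–Hough norm-equation parametrisation of `Cl(-d)[3]`:
  `d = (l m³ − l² n²)/t²` is DIAGONAL, so additive twists of `t(-d) − 2` separate into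
  one-dimensional quadratic (Gauss/Weyl) and cubic sums; reduced-form exact identity
  (`HeegnerNormCount`, kit j012142: 0 mismatches, d ≤ 6·10⁴), block identity
  (`hough_block_quadratic`), the cuspidal-cubic separation (`normEq_diagonal`), the 1-D engine
  (`QuadraticWeylBound`, `SquaresNearIntegers`) and the targets (`MinorArcTwistBound`,
  `UniformTwistPowerSaving`).
* `two-adic-van-der-corput` — binary digits are the 2-adic DEPTH aspect: the q-analogue of
  van der Corput with shifts `2^{m₁} h` on Bhargava's lattice (`disc_twoAdic_taylor`, kernel-checked
  Taylor step; `VdCSparseShifts`, the A-process inequality; target `DepthAspectTwistBound`).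

Everything here ELABORATES; the two polynomial identities are PROVED (`ring`).
-/

open scoped BigOperators
open Finset Filter

noncomputable section

namespace Summit.QuantumAdvantage.QuantumAdvantage.Cruxes.AcZeroRung.IdeatorG2K2

open Literature.NumberTheory.QuadraticFields
open Literature.NumberTheory.CubicFields

/-- `e(x) = exp(2πix)`. [folklore] -/
def eR (x : ℝ) : ℂ := Complex.exp (2 * Real.pi * Complex.I * x)

/-! ## Card A — `heegner-norm-diagonal` -/

/-- **Cuspidal-cubic separation.** The congruence `y² ≡ 4A³ (mod z²)` is the cuspidal cubic,
rationally parametrised by `(A, y) ≡ (u², 2u³)`; writing `A = u² + z² k`, `y = 2u³ + z² l` the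
norm equation gives `d = (4A³ − y²)/z² = P(k) − Q(l)` with `P` cubic in `k`, `Q` quadratic in `l`
and NO mixed monomial: additive phases `e(α d)` factor. [folklore] -/
theorem normEq_diagonal (u z k l : ℤ) :
    4 * (u ^ 2 + z ^ 2 * k) ^ 3 - (2 * u ^ 3 + z ^ 2 * l) ^ 2 =
      z ^ 2 * ((4 * z ^ 4 * k ^ 3 + 12 * u ^ 2 * z ^ 2 * k ^ 2 + 12 * u ^ 4 * k)
        - (z ^ 2 * l ^ 2 + 4 * u ^ 3 * l)) := by
  ring

/-- **Hough's block variable.** In Hough's normalisation `d = (l m³ − l² n²)/t²`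
(arXiv:1005.1458, Prop. 3.1 and §4.1) the long variable `n` runs in blocks `n = n₀ + 4s²t²·v`
(§4.1: "breaking it into blocks of length 4s²t²"); on a block, `t²·d` is a QUADRATIC polynomial in
`v` with leading coefficient `16 l² s⁴ t⁴`, i.e. `α d` has leading coefficient `θ = 16 α l² s⁴ t²`
and a linear coefficient through `n₀` only. [folklore] -/
theorem hough_block_quadratic (l m n₀ s t v : ℤ) :
    l * m ^ 3 - l ^ 2 * (n₀ + 4 * s ^ 2 * t ^ 2 * v) ^ 2 =
      (l * m ^ 3 - l ^ 2 * n₀ ^ 2) -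
        t ^ 2 * (16 * l ^ 2 * s ^ 4 * t ^ 2 * v ^ 2 + 8 * l ^ 2 * s ^ 2 * n₀ * v) := by
  ring

/-- The route's inline fundamentality filter for `-d`. [folklore] -/
def NegFund (d : ℕ) : Prop :=
  ((-(d:ℤ)) % 4 = 1 ∧ Squarefree (-(d:ℤ)) ∧ (-(d:ℤ)) ≠ 1) ∨
    (4 ∣ (-(d:ℤ)) ∧ ((-(d:ℤ)) / 4 % 4 = 2 ∨ (-(d:ℤ)) / 4 % 4 = 3) ∧ Squarefree ((-(d:ℤ)) / 4))

/-- The rational content of `ξ = (y + z√-d)/2 ∈ 𝓞_K`: the largest `g ∈ ℕ` with `ξ/g ∈ 𝓞_K`, in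
coordinates (`d` odd: `𝓞 = ℤ[ω]`, `ξ = (y−z)/2 + zω`; `4 ∣ d`: `ξ = y/2 + z√(-d/4)`). [folklore] -/
def xiContent (d : ℕ) (y z : ℤ) : ℕ :=
  if d % 2 = 1 then Int.gcd z ((y - z) / 2) else Int.gcd (y / 2) z

/-- Accepted norm-equation solutions attached to a form `Q = (A, B, C)` of discriminant `-d`:
`z ≠ 0`, `y² + d z² = 4A³`, `2A ∣ y + Bz` (this pins the cube root of `(ξ)` to the ideal
`[A, (−B+√-d)/2]`), and the PRIMITIVITY rule: the content of `ξ` is squarefree and divides `d`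
(content `1` = Hough's `l = 1`; content `g ∣ d` = his ramified factor `l = g`). The box only makes
the set a `Finset` (`|y| ≤ 2A^{3/2} ≤ 2d²`, `|z| ≤ d^{1/4} ≤ d`). [folklore] -/
def heegnerSolutions (d : ℕ) (Q : ℤ × ℤ × ℤ) : Finset (ℤ × ℤ) :=
  ((Icc (-(2 * (d:ℤ) ^ 2)) (2 * (d:ℤ) ^ 2)) ×ˢ (Icc (-(d:ℤ)) d)).filter fun yz =>
    yz.2 ≠ 0 ∧ yz.1 ^ 2 + (d:ℤ) * yz.2 ^ 2 = 4 * Q.1 ^ 3 ∧ 2 * Q.1 ∣ yz.1 + Q.2.1 * yz.2 ∧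
      Squarefree (xiContent d yz.1 yz.2) ∧ ((xiContent d yz.1 yz.2 : ℕ) : ℤ) ∣ (d:ℤ)

/-- **FIRST LEMMA of card `heegner-norm-diagonal` (exact reduced-form parametrisation of
`Cl(-d)[3]`).** For `-d` fundamental, `d > 4`: every reduced form carries `0` or `2` accepted
solutions, `2` exactly for the non-principal classes of order `3`; summed:
`2·(#Cl(-d)[3] − 1) = Σ_{Q reduced} #heegnerSolutions d Q`. This is Soundararajan's bijection
(JLMS 61 (2000) §2) / Hough arXiv:1005.1458 Prop. 3.1, moved from "all primitive ideals" to "the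
reduced ideal of each class". KIT-VERIFIED (j012142): all 18 236 fundamental `-d`, `4 < d ≤ 6·10⁴`,
1 374 556 reduced forms, 0 per-form mismatches, multiplicity exactly 2, `Σ = Σ h₃ = 32 464`.
[cite: arXiv:1005.1458, Prop. 3.1] -/
def HeegnerNormCount : Prop :=
  ∀ d : ℕ, 4 < d → NegFund d →
    2 * (quadFieldThreeTorsion (-(d:ℤ)) - 1) =
      ∑ Q ∈ BinaryQuadraticForm.reducedForms (-(d:ℤ)), (heegnerSolutions d Q).card

/-- **The 1-D engine, part 1: Weyl's inequality for quadratic polynomials** (Vaughan, *The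
Hardy–Littlewood method*, Lemma 2.4 with `k = 2`): uniform in the linear coefficient `φ`. A TRUE
theorem, M-sized in Lean (not in Mathlib). [cite: Vaughan1997, Lemma 2.4] -/
def QuadraticWeylBound : Prop :=
  ∀ ε : ℝ, 0 < ε → ∃ C : ℝ, ∀ (θ φ : ℝ) (a : ℤ) (q L : ℕ), 1 ≤ q → 1 ≤ L →
    |θ - a / q| ≤ 1 / (q:ℝ) ^ 2 →
    ‖∑ v ∈ Finset.range L, eR (θ * (v:ℝ) ^ 2 + φ * v)‖ ≤
      C * (L:ℝ) ^ (1 + ε) * (1 / (q:ℝ) + 1 / (L:ℝ) + (q:ℝ) / (L:ℝ) ^ 2) ^ (1 / 2 : ℝ)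

/-- **The 1-D engine, part 2: squares near integers** (the exceptional-set count for the outer
variable `w = l s² t ≤ W ≍ X^{1/4}`): for `|γ − a/q| ≤ q⁻²`,
`#{w ≤ W : ‖γ w²‖ ≤ η} ≪ W^{1+ε}(η + q^{-1/2} + W^{-1/2} + (q/W²)^{1/2})` — Selberg majorant +
`QuadraticWeylBound` (Baker, *Diophantine inequalities*, Ch. 3 type). [folklore] -/
def SquaresNearIntegers : Prop :=
  ∀ ε : ℝ, 0 < ε → ∃ C : ℝ, ∀ (γ η : ℝ) (a : ℤ) (q W : ℕ), 1 ≤ q → 1 ≤ W → 0 < η →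
    |γ - a / q| ≤ 1 / (q:ℝ) ^ 2 →
    ((((Finset.Icc 1 W).filter fun w : ℕ =>
        |γ * (w:ℝ) ^ 2 - round (γ * (w:ℝ) ^ 2)| ≤ η).card : ℕ) : ℝ) ≤
      C * (W:ℝ) ^ (1 + ε) * (η + (q:ℝ)⁻¹ ^ (1 / 2 : ℝ) + (W:ℝ)⁻¹ ^ (1 / 2 : ℝ)
        + ((q:ℝ) / (W:ℝ) ^ 2) ^ (1 / 2 : ℝ))

/-- **What the card's engine proves: power saving on the MINOR arcs** for the raw 3-torsion
twist (no centring needed off the major arcs: the flat `Σ_{fund} e(αD)` is itself `≪ X^{1-δ}`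
there). Major arcs `|α − a/q| ≤ X^{ε-1}`, `q ≤ X^ε` are the route's in-print inputs
(TT Thm 6 / card flat-pushforward). [folklore] -/
def MinorArcTwistBound : Prop :=
  ∀ ε : ℝ, 0 < ε → ∃ δ : ℝ, 0 < δ ∧ ∀ᶠ X : ℕ in atTop, ∀ α : ℝ,
    (¬ ∃ (a : ℤ) (q : ℕ), 1 ≤ q ∧ (q : ℝ) ≤ (X : ℝ) ^ ε ∧ |α - a / q| ≤ (X : ℝ) ^ (ε - 1)) →
    ‖∑ D ∈ negFundDiscrs X, ((quadFieldThreeTorsion D : ℝ) : ℂ) * eR (α * D)‖ ≤ (X : ℝ) ^ (1 - δ)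

/-- **C⁺ (shared target with cards outer-coefficient-bilinear-collapse /
sparse-walsh-additive-reduction — new engine here):** uniform additive-twist power saving for
`t − 2` along negative fundamental discriminants. [folklore] -/
def UniformTwistPowerSaving : Prop :=
  ∃ δ : ℝ, 0 < δ ∧ ∀ᶠ X : ℕ in atTop, ∀ α : ℝ,
    ‖∑ D ∈ negFundDiscrs X, (((quadFieldThreeTorsion D : ℝ) - 2 : ℝ) : ℂ) * eR (α * D)‖ ≤
      (X : ℝ) ^ (1 - δ)

/-- In-print major arcs (mean EXACTLY 2 in every progression to moduli `q ≤ X^ε`, with partial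
summation in `β`; TT Duke Thm 6 + Lemma 21, flat-pushforward's identity). [folklore] -/
def MajorArcTwistBound : Prop :=
  ∃ ε : ℝ, 0 < ε ∧ ∃ δ : ℝ, 0 < δ ∧ ∀ᶠ X : ℕ in atTop, ∀ α : ℝ, ∀ (a : ℤ) (q : ℕ),
    1 ≤ q → (q : ℝ) ≤ (X : ℝ) ^ ε → |α - a / q| ≤ (X : ℝ) ^ (ε - 1) →
    ‖∑ D ∈ negFundDiscrs X, (((quadFieldThreeTorsion D : ℝ) - 2 : ℝ) : ℂ) * eR (α * D)‖ ≤
      (X : ℝ) ^ (1 - δ)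

/-- The flat side on the minor arcs (elementary: `1_{sqfree} = Σ_{s²∣·} μ(s)`). [folklore] -/
def MinorArcFundDiscrs : Prop :=
  ∀ ε : ℝ, 0 < ε → ∃ δ : ℝ, 0 < δ ∧ ∀ᶠ X : ℕ in atTop, ∀ α : ℝ,
    (¬ ∃ (a : ℤ) (q : ℕ), 1 ≤ q ∧ (q : ℝ) ≤ (X : ℝ) ^ ε ∧ |α - a / q| ≤ (X : ℝ) ^ (ε - 1)) →
    ‖∑ D ∈ negFundDiscrs X, eR (α * D)‖ ≤ (X : ℝ) ^ (1 - δ)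

/-- Shape of the line (the glue is bookkeeping: split `α` by Dirichlet, triangle inequality). -/
def CardAShape : Prop :=
  HeegnerNormCount → QuadraticWeylBound → SquaresNearIntegers →
    MinorArcTwistBound ∧ (MinorArcTwistBound → MinorArcFundDiscrs → MajorArcTwistBound →
      UniformTwistPowerSaving)

/-! ## Card B — `two-adic-van-der-corput` -/

/-- `⟨∇Disc(a,b,c,d), (p,q,r,s)⟩` for the binary cubic discriminant. [folklore] -/
def gradDisc (a b c d p q r s : ℤ) : ℤ :=
  (-4 * c ^ 3 + 18 * b * c * d - 54 * a * d ^ 2) * p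
  + (2 * b * c ^ 2 - 12 * b ^ 2 * d + 18 * a * c * d) * q
  + (2 * b ^ 2 * c - 12 * a * c ^ 2 + 18 * a * b * d) * r
  + (-4 * b ^ 3 + 18 * a * b * c - 54 * a ^ 2 * d) * s

/-- The explicit second-order Taylor remainder of `Disc` along the shift `M·(p,q,r,s)`. [folklore] -/
def taylorRem (a b c d M p q r s : ℤ) : ℤ :=
  M ^ 2 * q ^ 2 * r ^ 2 - 4 * M ^ 2 * q ^ 3 * s - 4 * M ^ 2 * p * r ^ 3 + 18 * M ^ 2 * p * q * r * s
  - 27 * M ^ 2 * p ^ 2 * s ^ 2 - 4 * d * M * q ^ 3 + 18 * d * M * p * q * r - 54 * d * M * p ^ 2 * s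
  - 27 * d ^ 2 * p ^ 2 + 2 * c * M * q ^ 2 * r - 12 * c * M * p * r ^ 2 + 18 * c * M * p * q * s
  + 18 * c * d * p * q + c ^ 2 * q ^ 2 - 12 * c ^ 2 * p * r + 2 * b * M * q * r ^ 2
  - 12 * b * M * q ^ 2 * s + 18 * b * M * p * r * s - 12 * b * d * q ^ 2 + 18 * b * d * p * r
  + 4 * b * c * q * r + 18 * b * c * p * s + b ^ 2 * r ^ 2 - 12 * b ^ 2 * q * s - 4 * a * M * r ^ 3
  + 18 * a * M * q * r * s - 54 * a * M * p * s ^ 2 + 18 * a * d * q * r - 108 * a * d * p * s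
  - 12 * a * c * r ^ 2 + 18 * a * c * q * s + 18 * a * b * r * s - 27 * a ^ 2 * s ^ 2

/-- **2-adic Taylor step (kernel-checked).** `Disc(x + M h) = Disc(x) + M⟨∇Disc(x), h⟩ + M²·R`:
with `M = 2^{m₁}`, `2m₁ ≥ m`, the phase `e(a·Disc(x + 2^{m₁}h)/2^m)` differs from `e(a·Disc(x)/2^m)`
by the CUBIC phase `e(a⟨∇Disc(x), h⟩/2^{m−m₁})` of conductor `2^{m−m₁}` — the A-process of the
q-analogue of van der Corput, here with `q = 2^m` maximally smooth. [folklore] -/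
theorem disc_twoAdic_taylor (a b c d M p q r s : ℤ) :
    (⟨a + M * p, b + M * q, c + M * r, d + M * s⟩ : BinaryCubic ℤ).disc =
      (⟨a, b, c, d⟩ : BinaryCubic ℤ).disc + M * gradDisc a b c d p q r s
        + M ^ 2 * taylorRem a b c d M p q r s := by
  simp only [BinaryCubic.disc_eq, gradDisc, taylorRem]
  ring

/-- **A-process with sparse shifts** (van der Corput's inequality for the shift lattice `M·ℤ`):
for `f` supported in `[0, N)` with `|f| ≤ 1`,
`|Σ_x f(x)|² ≤ ((N + HM)/H) · 2 Σ_{0 ≤ h < H} |Σ_x f(x + hM) f̄(x)|`. Elementary (Cauchy–Schwarz);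
the `.lean` of the line states it on `ℤ⁴ ∩ box` with `M = 2^{m₁}`. [folklore] -/
def VdCSparseShifts : Prop :=
  ∀ (f : ℤ → ℂ) (N H M : ℕ), 1 ≤ H → 1 ≤ M → (∀ x, ‖f x‖ ≤ 1) →
    (∀ x : ℤ, (x < 0 ∨ (N : ℤ) ≤ x) → f x = 0) →
    ‖∑ x ∈ Finset.range N, f x‖ ^ 2 ≤
      (((N : ℝ) + H * M) / H) * (2 * ∑ h ∈ Finset.range H,
        ‖∑ x ∈ Finset.range N, f (x + h * M) * star (f x)‖)

/-- **C⁺ of card B: the depth-aspect twist bound.** Power saving for the centred 3-torsion twist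
at every PURE 2-adic frequency `h/2^m` of conductor `2^m ≤ X^{3/4 − δ}`, on every interval of
length `≥ X^{1-δ}` (AB-process range; conductors `≤ X^{1/2-δ}` are card dyadic-chirp-poisson's
B-process alone, the new octave `(X^{1/2}, X^{3/4})` is one 2-adic A-step + that B-step). [folklore] -/
def DepthAspectTwistBound : Prop :=
  ∀ δ : ℝ, 0 < δ → ∃ η : ℝ, 0 < η ∧ ∀ᶠ X : ℕ in atTop, ∀ (m h Y L : ℕ),
    (2 : ℝ) ^ m ≤ (X : ℝ) ^ (3 / 4 - δ) → Odd h → (X : ℝ) ^ (1 - δ) ≤ L → Y + L ≤ X →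
    ‖∑ D ∈ (negFundDiscrs X).filter (fun D => (Y : ℤ) ≤ -D ∧ -D < Y + L),
        (((quadFieldThreeTorsion D : ℝ) - 2 : ℝ) : ℂ) * eR (h * D / 2 ^ m)‖ ≤ (X : ℝ) ^ (1 - η)

end Summit.QuantumAdvantage.QuantumAdvantage.Cruxes.AcZeroRung.IdeatorG2K2

end
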